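import Mathlib
import Summits.Ventures.PercRepro2.HMFPendantB
import Summits.Ventures.PercRepro2.AttB

/-!
# (HMF) and (HCOV) at every pendant `a₃` at the marker `b` — unconditional
(blind cell PercRepro2, mine-a g9; the wiring of `AttB.attB_expr_nonneg` into night-1 g6's reduction)

`HMFPendantB.HMF_pendant_b` / `HCov_pendant_b` reduce (HMF), hence (HCOV), at a pendant `a₃` at `b`
to `0 ≤ attB`; `AttB.attB_expr_nonneg` proves `attB ≥ 0` on every finite graph (four instances of
BHK06 Thm 1.4 with set avoidance). Hence **`HMF_pendant_b'`**: the mean-field statement (HMF) holds at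
every pendant `a₃` at `b` — the pendant-at-`b` case of the (HMF) map. (`HCov_pendant_b'` is then a
second proof of p1's `PendantBRow.HCov_pendant_b`, which used the same avoidance instances.)
-/

namespace Summit.Ventures.PercRepro2
namespace HMFPendantB

open UnionCluster CovForm PendantRoot HMFPendantRoot

variable {V : Type*} {E : Type*} [Fintype E] [DecidableEq E] [Fintype V] [DecidableEq V]
  {R : Type*} [Field R] [LinearOrder R] [IsStrictOrderedRing R]

section Wiring

variable (p : E → R) (ends : E → Sym2 V) {f : E} {a₃ b : V}

/-- **(ATT-b) holds on every finite graph**: `0 ≤ attB` (`AttB.attB_expr_nonneg`). -/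
theorem attB_nonneg (hp : IsProbVec p) (o a₁ a₂ b : V) : 0 ≤ attB p ends o a₁ a₂ b := by
  unfold attB
  exact AttB.attB_expr_nonneg p ends hp o a₁ a₂ b

/-- **(HMF) at every pendant `a₃` at `b`** — unconditional. -/
theorem HMF_pendant_b' (hp : IsProbVec p) (hf : ends f = s(a₃, b))
    (hleaf : ∀ e, a₃ ∈ ends e → e = f) (h3b : a₃ ≠ b) {o a₁ a₂ : V} (h31 : a₃ ≠ a₁) (h32 : a₃ ≠ a₂)
    (ho : o ≠ a₃) : HMF p ends o a₁ a₂ a₃ b :=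
  HMF_pendant_b p ends hp hf hleaf h3b h31 h32 ho (attB_nonneg p ends hp o a₁ a₂ b)

/-- **(HCOV) at every pendant `a₃` at `b`** — unconditional (the open attachment case of the map). -/
theorem HCov_pendant_b' (hp : IsProbVec p) (hf : ends f = s(a₃, b))
    (hleaf : ∀ e, a₃ ∈ ends e → e = f) (h3b : a₃ ≠ b) {o a₁ a₂ : V} (h31 : a₃ ≠ a₁) (h32 : a₃ ≠ a₂)
    (ho : o ≠ a₃) : HCov p ends o a₁ a₂ a₃ b :=
  HCov_pendant_b p ends hp hf hleaf h3b h31 h32 ho (attB_nonneg p ends hp o a₁ a₂ b)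

end Wiring

end HMFPendantB
end Summit.Ventures.PercRepro2
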